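import Summits.Schanuel.Schanuel.Theses.DiophantineDichotomy
import Literature.NumberTheory.Transcendental.GelfondCriterionProofs

/-!
# `EPiSimultaneousType`: WLOG the annihilating polynomials are irreducible of exact degree
(Mignotte/Gelfond normal form of the admissibility clause; helper for crux `stmt-Schanuel-6118`)

`EPiSimultaneousType.clause_irreducible`: if `γ ∈ ℂ` is a root of SOME non-zero `P ∈ ℤ[X]` with
`deg P ≤ d` and naive height `≤ H` (the per-coordinate clause of the crux
`Summit.Schanuel.Schanuel.Theses.DiophantineDichotomy.EPiSimultaneousType`), then `γ` is a root of
an IRREDUCIBLE `Q ∈ ℤ[X]` (hence primitive: the minimal polynomial of `γ` over `ℤ` up to sign) with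
`deg Q = [ℚ(γ):ℚ] ≤ d` and naive height `≤ 8^d · H`. Ingredients: an irreducible factor of `P`
vanishing at `γ` (`exists_irreducible_dvd_aeval_eq_zero`, induction on the factorisation in the UFD
`ℤ[X]`); Mahler-measure monotonicity along divisibility and the bounds
`log H(Q) ≤ deg Q + log M(Q)`, `log M(P) ≤ deg P + log H(P)` (tree `GelfondCriterionProofs`,
from Mathlib's Landau and Mahler inequalities), so `log H(Q) ≤ 2d + log H`, `e² < 8`; Gauss's
lemma (`Irreducible.isPrimitive`, `IsPrimitive.irreducible_iff_irreducible_map_fraction_map`) and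
`minpoly.eq_of_irreducible` for the exact degree. So provers of the crux (and of
`KhovanskiiApproxType`) may assume every `Pᵢ` irreducible of degree `[ℚ(γᵢ):ℚ]`, at the price
`log H ↦ log H + 3d` (absorbed by `d^b`, `b ≥ a + 1`). Everything proved; no named facts;
cdisprove seat of crux 6118.
-/

set_option linter.dupNamespace false

noncomputable section

namespace Summit.Schanuel.Schanuel.Theorems

open Polynomial
open scoped IntermediateField

namespace EPiSimultaneousType

/-- An integer polynomial vanishing at `γ` has an irreducible factor of positive degree vanishing at
`γ`. [folklore] -/
theorem exists_irreducible_dvd_aeval_eq_zero (γ : ℂ) :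
    ∀ P : ℤ[X], P ≠ 0 → Polynomial.aeval γ P = 0 →
      ∃ Q : ℤ[X], Irreducible Q ∧ 0 < Q.natDegree ∧ Q ∣ P ∧ Polynomial.aeval γ Q = 0 := by
  intro P
  induction P using WfDvdMonoid.induction_on_irreducible with
  | zero => intro h; exact absurd rfl h
  | unit u hu =>
    intro _ hroot
    obtain ⟨r, hr, rfl⟩ := Polynomial.isUnit_iff.mp hu
    rw [aeval_C, algebraMap_int_eq, eq_intCast, Int.cast_eq_zero] at hroot
    exact absurd hroot hr.ne_zero
  | mul Q p hQ hp ih =>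
    intro hne hroot
    rw [map_mul, mul_eq_zero] at hroot
    rcases hroot with h | h
    · refine ⟨p, hp, ?_, dvd_mul_right p Q, h⟩
      by_contra hd
      have hd0 : p.natDegree = 0 := by omega
      rw [Polynomial.eq_C_of_natDegree_eq_zero hd0, aeval_C, algebraMap_int_eq, eq_intCast,
        Int.cast_eq_zero] at h
      exact hp.ne_zero (by rw [Polynomial.eq_C_of_natDegree_eq_zero hd0, h, C_0])
    · obtain ⟨R, hR, hRd, hRdvd, hRroot⟩ := ih hQ h
      exact ⟨R, hR, hRd, dvd_trans hRdvd (dvd_mul_left Q p), hRroot⟩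

/-- Height of a factor (Mignotte/Gelfond, via the Mahler measure): `Q ∣ P ≠ 0` in `ℤ[X]` gives
`log H(Q) ≤ deg Q + deg P + log H(P)`. [folklore] -/
theorem log_supNorm_le_of_dvd {Q P : ℤ[X]} (hP : P ≠ 0) (h : Q ∣ P) :
    Real.log Q.supNorm ≤ Q.natDegree + P.natDegree + Real.log P.supNorm := by
  have hQ : Q ≠ 0 := fun h0 => hP (by obtain ⟨R, rfl⟩ := h; rw [h0, zero_mul])
  have h1 := Polynomial.log_supNorm_le hQ
  have h2 := Polynomial.logMahlerMeasure_map_le_of_dvd hP h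
  have h3 := Polynomial.logMahlerMeasure_map_le hP
  linarith

/-- `supNorm P ≤ H` from the coefficientwise bound of the clause. [folklore] -/
theorem supNorm_le_of_coeff_le {P : ℤ[X]} {H : ℕ} (hH : ∀ k, |P.coeff k| ≤ (H : ℤ)) :
    P.supNorm ≤ H := by
  obtain ⟨i, hi⟩ := P.exists_eq_supNorm
  rw [hi, Int.norm_eq_abs]
  exact_mod_cast hH i

/-- **Irreducible witness for the clause.** If `γ` is a root of a non-zero integer polynomial of
degree `≤ d` and naive height `≤ H`, then it is a root of an IRREDUCIBLE `Q ∈ ℤ[X]` with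
`deg Q = [ℚ(γ):ℚ] ≤ d` and naive height `≤ 8^d H`. [folklore] -/
theorem clause_irreducible {γ : ℂ} {d H : ℕ}
    (h : ∃ P : Polynomial ℤ, P ≠ 0 ∧ P.natDegree ≤ d ∧ (∀ k, |P.coeff k| ≤ (H : ℤ)) ∧
      Polynomial.aeval γ P = 0) :
    ∃ Q : Polynomial ℤ, Irreducible Q ∧ Q.natDegree = Module.finrank ℚ ↥ℚ⟮γ⟯ ∧
      Q.natDegree ≤ d ∧ (∀ k, |Q.coeff k| ≤ ((8 ^ d * H : ℕ) : ℤ)) ∧ Polynomial.aeval γ Q = 0 := by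
  obtain ⟨P, hP0, hdeg, hH, hroot⟩ := h
  obtain ⟨Q, hQirr, hQd, hQdvd, hQroot⟩ := exists_irreducible_dvd_aeval_eq_zero γ P hP0 hroot
  have hQ0 : Q ≠ 0 := hQirr.ne_zero
  have hQle : Q.natDegree ≤ P.natDegree := Polynomial.natDegree_le_of_dvd hQdvd hP0
  -- exact degree via Gauss + minpoly
  have hprim : Q.IsPrimitive := hQirr.isPrimitive (by omega)
  have hirrQ : Irreducible (Q.map (algebraMap ℤ ℚ)) :=
    (Polynomial.IsPrimitive.irreducible_iff_irreducible_map_fraction_map hprim).mp hQirr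
  have hrootQ : Polynomial.aeval γ (Q.map (algebraMap ℤ ℚ)) = 0 := by
    rw [Polynomial.aeval_map_algebraMap]; exact hQroot
  have hint : IsIntegral ℚ γ := isAlgebraic_iff_isIntegral.mp ⟨Q.map (algebraMap ℤ ℚ),
    hirrQ.ne_zero, hrootQ⟩
  have hmin := minpoly.eq_of_irreducible hirrQ hrootQ
  have hdegQ : Q.natDegree = Module.finrank ℚ ↥ℚ⟮γ⟯ := by
    rw [IntermediateField.adjoin.finrank hint, ← hmin, Polynomial.natDegree_mul_C, 
      Polynomial.natDegree_map_eq_of_injective (algebraMap ℤ ℚ).injective_int]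
    exact inv_ne_zero (Polynomial.leadingCoeff_ne_zero.mpr hirrQ.ne_zero)
  refine ⟨Q, hQirr, hdegQ, hQle.trans hdeg, fun k => ?_, hQroot⟩
  -- heights
  have hH1 : (1 : ℝ) ≤ H := by
    have : (1 : ℝ) ≤ P.supNorm := Polynomial.one_le_supNorm_of_ne_zero hP0
    exact this.trans (supNorm_le_of_coeff_le hH)
  have hlogQ := log_supNorm_le_of_dvd hP0 hQdvd
  have hsupP : Real.log P.supNorm ≤ Real.log H :=
    Real.log_le_log (lt_of_lt_of_le one_pos (Polynomial.one_le_supNorm_of_ne_zero hP0))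
      (supNorm_le_of_coeff_le hH)
  have hlog : Real.log Q.supNorm ≤ 2 * d + Real.log H := by
    have h1 : (Q.natDegree : ℝ) ≤ d := by exact_mod_cast hQle.trans hdeg
    have h2 : (P.natDegree : ℝ) ≤ d := by exact_mod_cast hdeg
    linarith
  have hsupQ : Q.supNorm ≤ (8 : ℝ) ^ d * H := by
    have hQpos : 0 < Q.supNorm := lt_of_lt_of_le one_pos (Polynomial.one_le_supNorm_of_ne_zero hQ0)
    rw [← Real.log_le_log_iff hQpos (by positivity), Real.log_mul (by positivity) (by positivity),
      Real.log_pow]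
    have hlog8 : (2 : ℝ) ≤ Real.log 8 := by
      rw [show (8 : ℝ) = 2 ^ (3 : ℕ) by norm_num, Real.log_pow]
      have := Real.log_two_gt_d9
      push_cast
      linarith
    nlinarith
  have hk : ‖Q.coeff k‖ ≤ Q.supNorm := Q.le_supNorm k
  rw [Int.norm_eq_abs] at hk
  have : (|Q.coeff k| : ℝ) ≤ ((8 ^ d * H : ℕ) : ℝ) := by
    push_cast
    exact hk.trans hsupQ
  exact_mod_cast this

end EPiSimultaneousType

end Summit.Schanuel.Schanuel.Theorems

end
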